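import Mathlib
import HarnessLib
import Summits.Parity.GeneralizedHardyLittlewood.Theses.LeeYangFibres

/-!
# SketchIdeator1 — crux-ideate stmt-Parity-14108 (FibreHyperbolicity), ideator 1

First-lemma signatures for the idea cards in `Ideas/`:

* `brenti-shadow`                 → `RoughCycleHyperbolic` (= Brenti 1995 Cor 5.9, known), `RoughCycleCompatible`
* `buchstab-pencil-compatibility` → `CondDescendantCompatibility` (inductive step), `TwoLevelCompatibility` (flagged restatement), `RoughTuplesExist`
* `hankel-dip-ladder`             → `ModelDipLadder`, `TiltedSignLadder`

Nothing here is proved; every `def … : Prop` must elaborate (`lean check` rc 0, no sorry).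
-/

namespace Summit.Parity.GeneralizedHardyLittlewood.Cruxes.FibreHyperbolicity.Ideator1

open scoped BigOperators Classical
open Literature.NumberTheory.Sieve

/-! ## Card `stirling-shadow`: rough-permutation cycle polynomials -/

/-- The cycle polynomial of `m`-rough permutations of `Fin n` (`m ≥ 1`): sum over permutations
with no fixed point and every cycle of length `> m` of `ζ ^ (number of cycles)`.  For `m = 0`
(not covered by this encoding, fixed points are not in `cycleType`) it would be the Stirling
product `ζ (ζ+1) ⋯ (ζ+n-1)`. -/
noncomputable def roughCyclePoly (n m : ℕ) (ζ : ℂ) : ℂ :=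
  ∑ σ : Equiv.Perm (Fin n),
    if σ.support = Finset.univ ∧ ∀ ℓ ∈ σ.cycleType, m < ℓ then ζ ^ Multiset.card σ.cycleType else 0

/-- FIRST LEMMA of card `stirling-shadow` (parity-free, finite combinatorics): the cycle
polynomial of `m`-rough permutations is real-rooted for all `n ≥ m + 1 ≥ 2`
(kit j005057 part A certifies instances exactly). Its `n → ∞`, `n/m → u` limit is the
Buchstab–Dickman cell polynomial of `ModelHyperbolicity`. -/
def RoughCycleHyperbolic : Prop :=
  ∀ n m : ℕ, 1 ≤ m → m + 1 ≤ n → ∀ ζ : ℂ, roughCyclePoly n m ζ = 0 → ζ.im = 0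

/-- Compatibility along the discrete Buchstab recursion
`A_{n+1,m} = n·A_{n,m} + ζ·(n!/(n-m)!)·A_{n-m,m}`: every non-negative combination of `A_{n,m}`
and `ζ·A_{n-m,m}` is real-rooted (Hermite–Kakeya–Obreschkoff form of "interlacing template"). -/
def RoughCycleCompatible : Prop :=
  ∀ n m : ℕ, 1 ≤ m → m + 1 ≤ n → ∀ c : ℝ, 0 ≤ c →
    ∀ ζ : ℂ, roughCyclePoly n m ζ + (c : ℂ) * ζ * roughCyclePoly (n - m) m ζ = 0 → ζ.im = 0

/-- Observed STRENGTHENING (kit j005551: 2548/2548 partner pairs interlace): the recursion partners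
`A_{n,m}` and `ζ·A_{n-m,m}` have interlacing zeros, i.e. (Hermite–Kakeya–Obreschkoff / Dedieu) every REAL
combination is real-rooted — strong compatibility, not only the `c ≥ 0` half of `RoughCycleCompatible`.
Conjectural; it would give strictness of the inductive step and a second route to simple zeros. -/
def RoughCycleInterlacing : Prop :=
  ∀ n m : ℕ, 1 ≤ m → 2 * m + 2 ≤ n → ∀ c : ℝ,
    ∀ ζ : ℂ, roughCyclePoly n m ζ + (c : ℂ) * ζ * roughCyclePoly (n - m) m ζ = 0 → ζ.im = 0

/-- FIRST NEW LEMMA of card `brenti-shadow`: uniform root separation of the shadow rows in the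
PROPORTIONAL regime `n ≤ u₀·m` (all roots simple, distinct roots at least `c(u₀)` apart). Brenti 1995
Cor 5.9 gives reality; this is what passes SIMPLE zeros to the limit `F(u,·)`, `u ≤ u₀`
(kit j005551 part A measures the gaps). -/
def RoughCycleSeparated : Prop :=
  ∀ u₀ : ℕ, ∃ c : ℝ, 0 < c ∧ ∀ n m : ℕ, 1 ≤ m → m + 1 ≤ n → n ≤ u₀ * m →
    (∀ ζ : ℂ, roughCyclePoly n m ζ = 0 → deriv (roughCyclePoly n m) ζ ≠ 0) ∧
    (∀ ζ₁ ζ₂ : ℂ, roughCyclePoly n m ζ₁ = 0 → roughCyclePoly n m ζ₂ = 0 → ζ₁ ≠ ζ₂ → c ≤ ‖ζ₁ - ζ₂‖)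

/-! ## Card `buchstab-pencil-compatibility`: cells, fibres, descendants, pencils -/

/-- Joint rough `Ω`-cell count of the system `Ψ` on `K` at REAL roughness exponent `v`
(threshold `N^{1/v}`), cell index `j`. At `v = u ∈ ℕ` this is literally the cell of the crux. -/
noncomputable def jointCell (t N : ℕ) (v : ℝ) (Ψ : Fin t → AffLinForm 1) (K : Set (Fin 1 → ℝ))
    (j : Fin t → ℕ) : ℕ :=
  ((latticeBox 1 N).filter (fun n => realPoint n ∈ K ∧
      ∀ k, (N : ℝ) ^ ((1 : ℝ) / v) < (Nat.minFac ((Ψ k).eval n).toNat : ℝ) ∧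
        ArithmeticFunction.cardFactors ((Ψ k).eval n).toNat = j k)).card

/-- Fibre polynomial in coordinate `i`, frozen fugacities `w`, degree cut-off `u`, roughness
exponent `v`. -/
noncomputable def fibrePoly (t N u : ℕ) (v : ℝ) (Ψ : Fin t → AffLinForm 1) (K : Set (Fin 1 → ℝ))
    (i : Fin t) (w : Fin t → ℝ) (ζ : ℂ) : ℂ :=
  ∑ j ∈ Fintype.piFinset (fun _ : Fin t => Finset.Icc 1 u),
    ((jointCell t N v Ψ K j : ℕ) : ℂ) * ∏ k, (if k = i then ζ else ((w k : ℝ) : ℂ)) ^ (j k)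

/-- The UNCONDITIONAL two-level pencil (card `buchstab-pencil-compatibility`, kept for reference and
FLAGGED): across a roughness window `[v', v]` of length `≤ 1`, every non-negative combination of the
coarser fibre polynomial and the Buchstab increment is zero or real-rooted.  Its member
`(a, b) = (1, 1)` is the fibre polynomial at level `v` itself, so this Prop CONTAINS the crux (at every
level `≤ u`) — it is a strengthening-with-extras, not a transfer; the card's transfer is the conditional
inductive step `CondDescendantCompatibility` below. -/
def TwoLevelCompatibility : Prop :=
  ∀ (t L u₀ : ℕ), 1 ≤ t → ∀ η : ℝ, 0 < η → ∃ u : ℕ, u₀ ≤ u ∧ 2 ≤ u ∧ ∃ N₀ : ℕ, ∀ N : ℕ, N₀ ≤ N →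
    ∀ Ψ : Fin t → AffLinForm 1, IsNondegenerateSystem Ψ → affLinSize Ψ N ≤ L →
    ∀ K : Set (Fin 1 → ℝ), Convex ℝ K → K ⊆ realBox 1 N →
    η * (N : ℝ) ≤ archFactor Ψ K * singularProduct Ψ →
    ∀ i : Fin t, ∀ w : Fin t → ℝ, (∀ k, 0 < w k ∧ w k ≤ 1) →
    ∀ v v' : ℝ, 2 ≤ v' → v' ≤ v → v ≤ v' + 1 → v ≤ u →
    ∀ a b : ℝ, 0 ≤ a → 0 ≤ b →
      (∀ ζ : ℂ, (a : ℂ) * fibrePoly t N u v' Ψ K i w ζ +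
          (b : ℂ) * (fibrePoly t N u v Ψ K i w ζ - fibrePoly t N u v' Ψ K i w ζ) = 0) ∨
      (∀ ζ : ℂ, (a : ℂ) * fibrePoly t N u v' Ψ K i w ζ +
          (b : ℂ) * (fibrePoly t N u v Ψ K i w ζ - fibrePoly t N u v' Ψ K i w ζ) = 0 → ζ.im = 0)

/-- `f` is the zero function or has only real zeros — the Chudnovsky–Seymour convention that lets
compatibility statements carry no existence content. -/
def ZeroOrRealRooted (f : ℂ → ℂ) : Prop :=
  (∀ ζ : ℂ, f ζ = 0) ∨ (∀ ζ : ℂ, f ζ = 0 → ζ.im = 0)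

/-- One-prime DESCENDANT cell: tuples `n ∈ K` for which the prime `p` divides the `k`-th form,
every other form is `p`-rough (least prime factor `> p`), the cofactor `ψ_k(n)/p` is `1` or has
least prime factor `≥ p`, and the `Ω`-pattern with that one factor `p` removed from `ψ_k` is `j`
(`j k` may be `0`).  Summing `descCell` over the primes of a window is the exact Buchstab
increment of `jointCell` (up to tuples where `p` divides two forms or `p² ∣ ψ_k(n)`, a
power-saving garbage term). In the variable `m = (n - n₀)/p` these are the joint cells of the
DILATED system `(ψ_l(n₀ + p m))_{l ≠ k}, ψ_k(n₀ + p m)/p` at roughness threshold `p`. -/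
noncomputable def descCell (t N p : ℕ) (k : Fin t) (Ψ : Fin t → AffLinForm 1) (K : Set (Fin 1 → ℝ))
    (j : Fin t → ℕ) : ℕ :=
  ((latticeBox 1 N).filter (fun n => realPoint n ∈ K ∧ p ∣ ((Ψ k).eval n).toNat ∧
      (((Ψ k).eval n).toNat / p = 1 ∨ p ≤ Nat.minFac (((Ψ k).eval n).toNat / p)) ∧
      ArithmeticFunction.cardFactors (((Ψ k).eval n).toNat / p) = j k ∧
      ∀ l, l ≠ k → (p : ℝ) < (Nat.minFac ((Ψ l).eval n).toNat : ℝ) ∧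
        ArithmeticFunction.cardFactors ((Ψ l).eval n).toNat = j l)).card

/-- Descendant fibre polynomial in coordinate `i` (frozen `w`), for the descendant `(k, p)`. -/
noncomputable def descPoly (t N u p : ℕ) (i k : Fin t) (Ψ : Fin t → AffLinForm 1)
    (K : Set (Fin 1 → ℝ)) (w : Fin t → ℝ) (ζ : ℂ) : ℂ :=
  ∑ j ∈ Fintype.piFinset (fun _ : Fin t => Finset.Icc 0 u),
    ((descCell t N p k Ψ K j : ℕ) : ℂ) * ∏ l, (if l = i then ζ else ((w l : ℝ) : ℂ)) ^ (j l)

/-- The monomial by which the descendant `(k, p)` re-enters the fibre polynomial of coordinate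
`i`: `ζ` if the peeled prime sat in form `i`, else the frozen fugacity `w k`. -/
noncomputable def reentry (t : ℕ) (i k : Fin t) (w : Fin t → ℝ) (ζ : ℂ) : ℂ :=
  if k = i then ζ else ((w k : ℝ) : ℂ)

/-- FIRST LEMMA of card `buchstab-pencil-compatibility` — the INDUCTIVE STEP, stated
conditionally so that no member restates the crux: IF the coarser fibre polynomial (exponent
`v'`) and a one-prime descendant piece (prime `p` in the next window, form `k`) are each zero or
real-rooted, THEN every non-negative combination of them is zero or real-rooted; and likewise
for two descendant pieces.  With Chudnovsky–Seymour 2.2 (pairwise compatible ⟹ compatible) this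
propagates real-rootedness one prime window down the Buchstab flow.  Typed in the Green–Tao
class as the first checkable instance; the line's honest object is the dilation-closed class
(definition request), on which the same statement closes the induction. -/
def CondDescendantCompatibility : Prop :=
  ∀ (t L u₀ : ℕ), 1 ≤ t → ∀ η : ℝ, 0 < η → ∃ u : ℕ, u₀ ≤ u ∧ 2 ≤ u ∧ ∃ N₀ : ℕ, ∀ N : ℕ, N₀ ≤ N →
    ∀ Ψ : Fin t → AffLinForm 1, IsNondegenerateSystem Ψ → affLinSize Ψ N ≤ L →
    ∀ K : Set (Fin 1 → ℝ), Convex ℝ K → K ⊆ realBox 1 N →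
    η * (N : ℝ) ≤ archFactor Ψ K * singularProduct Ψ →
    ∀ i : Fin t, ∀ w : Fin t → ℝ, (∀ k, 0 < w k ∧ w k ≤ 1) →
    ∀ v' : ℝ, 2 ≤ v' → v' + 1 ≤ u →
    ∀ p p' : ℕ, p.Prime → p'.Prime →
      (N : ℝ) ^ (1 / (v' + 1)) ≤ p → (p : ℝ) < (N : ℝ) ^ (1 / v') →
      (N : ℝ) ^ (1 / (v' + 1)) ≤ p' → (p' : ℝ) < (N : ℝ) ^ (1 / v') →
    ∀ k k' : Fin t,
      ZeroOrRealRooted (fibrePoly t N u v' Ψ K i w) →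
      ZeroOrRealRooted (fun ζ => reentry t i k w ζ * descPoly t N u p i k Ψ K w ζ) →
      ZeroOrRealRooted (fun ζ => reentry t i k' w ζ * descPoly t N u p' i k' Ψ K w ζ) →
      (∀ c : ℝ, 0 ≤ c → ZeroOrRealRooted (fun ζ =>
          fibrePoly t N u v' Ψ K i w ζ + (c : ℂ) * (reentry t i k w ζ * descPoly t N u p i k Ψ K w ζ))) ∧
      (∀ c : ℝ, 0 ≤ c → ZeroOrRealRooted (fun ζ =>
          reentry t i k w ζ * descPoly t N u p i k Ψ K w ζ +
            (c : ℂ) * (reentry t i k' w ζ * descPoly t N u p' i k' Ψ K w ζ)))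

/-- Non-emptiness of the joint rough cells at the cut-off level (a sieve LOWER bound for rough
tuples; provable by the fundamental lemma for `u ≥ u₁(t)`), isolated because the refuter's
`Probe14108.cells_nonempty_of_FH` shows any proof of the crux must supply it. -/
def RoughTuplesExist : Prop :=
  ∀ (t L u₀ : ℕ), 1 ≤ t → ∀ η : ℝ, 0 < η → ∃ u : ℕ, u₀ ≤ u ∧ 2 ≤ u ∧ ∃ N₀ : ℕ, ∀ N : ℕ, N₀ ≤ N →
    ∀ Ψ : Fin t → AffLinForm 1, IsNondegenerateSystem Ψ → affLinSize Ψ N ≤ L →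
    ∀ K : Set (Fin 1 → ℝ), Convex ℝ K → K ⊆ realBox 1 N →
    η * (N : ℝ) ≤ archFactor Ψ K * singularProduct Ψ →
    ∃ j : Fin t → ℕ, (∀ k, 1 ≤ j k ∧ j k ≤ u) ∧ 0 < jointCell t N (u : ℝ) Ψ K j

/-- Shape of the composition the crux-plan would certify (stated, not proved here). -/
def twoLevel_implies_FH : Prop :=
  TwoLevelCompatibility → RoughTuplesExist →
    Summit.Parity.GeneralizedHardyLittlewood.Theses.LeeYangFibres.FibreHyperbolicity

/-! ## Card `hankel-dip-ladder`: sign ladder at half-integer test points -/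

/-- The tilted sign ladder, BULK rungs (card `hankel-dip-ladder`): for `k + 1 ≤ u/3 < u/e` the
fibre polynomial of the crux divided by `ζ` has sign `(-1)^k` at the half-integer `ζ = -(k + 1/2)` —
each rung is a ONE-SIDED inequality between `(k+½)`-tilted joint cells (a Liouville-type sign
statement on rough tuples); all `⌊u⌋` rungs (bulk + rescaled top rungs, see the card) give `⌊u⌋`
sign changes, hence FibreHyperbolicity with simple zeros.  Implied by HL at fixed `u`; stated as
the first arithmetic check of the line. -/
def TiltedSignLadder : Prop :=
  ∀ (t L u₀ : ℕ), 1 ≤ t → ∀ η : ℝ, 0 < η → ∃ u : ℕ, u₀ ≤ u ∧ 2 ≤ u ∧ ∃ N₀ : ℕ, ∀ N : ℕ, N₀ ≤ N →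
    ∀ Ψ : Fin t → AffLinForm 1, IsNondegenerateSystem Ψ → affLinSize Ψ N ≤ L →
    ∀ K : Set (Fin 1 → ℝ), Convex ℝ K → K ⊆ realBox 1 N →
    η * (N : ℝ) ≤ archFactor Ψ K * singularProduct Ψ →
    ∀ i : Fin t, ∀ w : Fin t → ℝ, (∀ k, 0 < w k ∧ w k ≤ 1) →
    ∀ k : ℕ, ((k : ℝ) + 1) * 3 ≤ u →
      0 < (-1 : ℝ) ^ k * (fibrePoly t N u (u : ℝ) Ψ K i w (-((k : ℂ) + 1 / 2)) / (-((k : ℂ) + 1 / 2))).re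


/-! ## Card `hankel-dip-ladder`: the model densities and the sign/dip ladder -/

/-- Buchstab–Dickman `Ω`-cell densities `I_j(u)`: `I_1 = 1_{u ≥ 1}`,
`I_j(u) = ∫_{j-1}^{u-1} I_{j-1}(v) dv / v` (so `∂_u I_j = I_{j-1}(u-1)/(u-1)`, `I_2 = log (u-1)`);
`A_j(N) ~ I_j(u) N / log N` for `N^{1/u}`-rough integers (Alladi). No tree declaration exists yet
(the route asks for one next to `BuchstabFunction.lean`). -/
noncomputable def cellDensity : ℕ → ℝ → ℝ
  | 0 => fun _ => 0
  | 1 => fun u => if 1 ≤ u then 1 else 0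
  | (j + 2) => fun u => ∫ v in ((j : ℝ) + 1)..(u - 1), cellDensity (j + 1) v / v

/-- The model cell polynomial `F(u, ζ) = Σ_{1 ≤ j ≤ d} I_j(u) ζ^j` (the refuter's `q_u` times `ζ`). -/
noncomputable def modelPoly (u : ℝ) (d : ℕ) (ζ : ℂ) : ℂ :=
  ∑ j ∈ Finset.range (d + 1), ((cellDensity j u : ℝ) : ℂ) * ζ ^ j

/-- FIRST LEMMA of card `hankel-dip-ladder` (model rung, parity-free, checkable by kit and
provable by uniform asymptotics of `I_j(u)`; kit j011960 checks it for `u ≤ 30`): in the BULK range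
`k + 1 ≤ u / 3` the model
polynomial divided by `ζ` has sign `(-1)^k` at the half-integer `-(k + 1/2)` and is bounded
below there by half the `1/Γ` prediction `e^{γ(k+½)} u^{-(k+½)} / |Γ(½ - k)|` for `F(u,ζ)/ζ`
(the DIP that the parity perturbation `θ·F(u,-ζ)` must not fill). -/
def ModelDipLadder : Prop :=
  ∃ u₀ : ℝ, ∀ u : ℝ, u₀ ≤ u → ∀ k : ℕ, ((k : ℝ) + 1) * 3 ≤ u →
    (1 / 2 : ℝ) * (Real.exp (Real.eulerMascheroniConstant * ((k : ℝ) + 1 / 2)) *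
        u ^ (-((k : ℝ) + 1 / 2)) / |Real.Gamma (1 / 2 - k)|)
      ≤ (-1 : ℝ) ^ k * (modelPoly u (Nat.floor u) (-((k : ℂ) + 1 / 2)) / (-((k : ℂ) + 1 / 2))).re

end Summit.Parity.GeneralizedHardyLittlewood.Cruxes.FibreHyperbolicity.Ideator1
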